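import Literature.Analysis.FluidPDE.ElgindiAprioriCutoff
import Literature.Analysis.FluidPDE.ElgindiStabilityDecompositionProofs
import Literature.Analysis.FluidPDE.ElgindiHkTools
import Mathlib.Algebra.Order.Chebyshev
import HarnessLib

/-!
# The `𝓗⁴` functional of radial products: small multipliers, cut-off limits, Fatou
([Elgindi2021] §7.3 Step 3; [ElgindiGhoulMasmoudi2021] §1.7, Remark 9.8)

Topic `Literature/Analysis/FluidPDE`. Support file (definitions with bodies and proved theorems, no
named facts) on the proof path of the named fact
`Literature.Analysis.FluidPDE.Elgindi.ElgindiGhoulMasmoudi2021_stabilityCore`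
(`ElgindiStabilityDecomposition.lean`). T. M. Elgindi, Ann. of Math. 194 (2021) =
arXiv:1904.04795, §7.3 (p. 21); Elgindi–Ghoul–Masmoudi, arXiv:1910.14071, §1.7 (p. 6), Remark 9.8
(p. 20).

* `eHkNormSq_radialMul_le`: if all `Dz₁^lc`, `l ≤ 4`, are bounded by `ε` on `(0,∞)` then
  `|cG|²_{𝓗⁴} ≤ 5400ε²|G|²_{𝓗⁴}` (Leibniz on the strip + `(Σ_{l≤j} x_l)² ≤ (j+1)Σx_l²`).
* `tendsto_iterate_radialMul_etaCut`: `D_θ^iD_R^j(η_nG) → D_θ^iD_R^jG` pointwise on the strip for the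
  logarithmic cut-offs `η_n`.
* `eHkNormSq_le_liminf`: Fatou for the `𝓗ᵏ` functional under pointwise convergence of all mixed
  iterates on the strip (the functional is one lower integral of a finite sum of squares).
-/

noncomputable section

open MeasureTheory Set Real Filter Function Finset
open _root_.Topology
open scoped ENNReal ContDiff

namespace Literature.Analysis.FluidPDE

namespace Elgindi

/-! ### Measurability of the terms for strip-smooth functions -/

/-- Radial terms of strip-`C^N` functions are a.e.-measurable on the strip. [folklore] -/
theorem aemeasurable_hkRadialTerm_strip {G : ℝ → ℝ → ℝ} {N j : ℕ} (hG : ContDiffOn ℝ N (uncurry G) strip) (hj : j ≤ N) :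
    AEMeasurable (uncurry (hkRadialTerm j G)) (volume.restrict strip) := by
  have hc : ContinuousOn (uncurry (Dθ^[0] (Dz^[j] G))) strip := continuousOn_iterate_Dθ_Dz hG (by omega)
  have e : uncurry (hkRadialTerm j G) = fun p : ℝ × ℝ => uncurry (Dθ^[0] (Dz^[j] G)) p * hWeight p.1 p.2 := by
    funext p; rfl
  rw [e]
  exact (hc.mul continuousOn_hWeight).aemeasurable measurableSet_strip

/-- Mixed terms of strip-`C^N` functions are a.e.-measurable on the strip. [folklore] -/
theorem aemeasurable_hkMixedTerm_strip (α : ℝ) {G : ℝ → ℝ → ℝ} {N i j : ℕ} (hG : ContDiffOn ℝ N (uncurry G) strip) (hij : i + j ≤ N) :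
    AEMeasurable (uncurry (hkMixedTerm α i j G)) (volume.restrict strip) := by
  have hc : ContinuousOn (uncurry (Dθ^[i] (Dz^[j] G))) strip := continuousOn_iterate_Dθ_Dz hG hij
  have e : uncurry (hkMixedTerm α i j G) = fun p : ℝ × ℝ => uncurry (Dθ^[i] (Dz^[j] G)) p * uncurry (totalWeight α) p := by
    funext p; rfl
  rw [e]
  exact (hc.mul (continuousOn_totalWeight α)).aemeasurable measurableSet_strip

/-! ### Small radial multipliers -/

/-- Binomial coefficients `C(j,l) ≤ 16` for `j ≤ 4`. [folklore] -/
theorem choose_le_sixteen {j l : ℕ} (hj : j ≤ 4) : (j.choose l : ℝ) ≤ 16 := by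
  have h1 : j.choose l ≤ 2 ^ j := Nat.choose_le_two_pow j l
  have h2 : 2 ^ j ≤ 2 ^ 4 := Nat.pow_le_pow_right (by norm_num) hj
  have : j.choose l ≤ 16 := h1.trans (by simpa using h2)
  exact_mod_cast this

/-- **The pointwise Leibniz bound**: with `|Dz₁^lc| ≤ ε` (`l ≤ j ≤ 4`) on `(0,∞)`,
`(D_θ^iD_R^j(cG))² ≤ 1280ε² Σ_{l≤j} (D_θ^iD_R^lG)²` on the strip. [folklore] -/
theorem sq_iterate_radialMul_le {c : ℝ → ℝ} {N : ℕ} (hc : ContDiffOn ℝ N c (Ioi 0)) {ε : ℝ}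
    (hb : ∀ l, l ≤ 4 → ∀ z ∈ Ioi (0:ℝ), |(Dz₁^[l] c) z| ≤ ε) {G : ℝ → ℝ → ℝ} (hG : ContDiffOn ℝ N (uncurry G) strip)
    {i j : ℕ} (hij : i + j ≤ N) (hj : j ≤ 4) {p : ℝ × ℝ} (hp : p ∈ strip) :
    (Dθ^[i] (Dz^[j] (radialMul c G)) p.1 p.2) ^ 2 ≤ 1280 * ε ^ 2 * ∑ l ∈ range (j + 1), (Dθ^[i] (Dz^[l] G) p.1 p.2) ^ 2 := by
  rw [iterate_Dθ_Dz_radialMul_Ioi hc hG hij p hp]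
  -- `(Σ x_l)² ≤ (j+1) Σ x_l²` and `x_l² ≤ 256 ε² (D_θ^iD_R^{j-l}G)²`
  have h1 := sq_sum_le_card_mul_sum_sq (s := range (j + 1)) (f := fun l => (j.choose l : ℝ) * ((Dz₁^[l] c) p.1 * Dθ^[i] (Dz^[j - l] G) p.1 p.2))
  rw [card_range] at h1
  have h2 : ∀ l ∈ range (j + 1), ((j.choose l : ℝ) * ((Dz₁^[l] c) p.1 * Dθ^[i] (Dz^[j - l] G) p.1 p.2)) ^ 2 ≤
      256 * ε ^ 2 * (Dθ^[i] (Dz^[j - l] G) p.1 p.2) ^ 2 := by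
    intro l hl
    have hl' : l ≤ j := Nat.lt_succ_iff.1 (mem_range.1 hl)
    have hcl : (j.choose l : ℝ) ^ 2 ≤ 256 := by
      have h0 : 0 ≤ (j.choose l : ℝ) := by positivity
      nlinarith [choose_le_sixteen (l := l) hj]
    have hDl : ((Dz₁^[l] c) p.1) ^ 2 ≤ ε ^ 2 := by
      rw [← sq_abs]; exact pow_le_pow_left₀ (abs_nonneg _) (hb l (hl'.trans hj) p.1 hp.1) 2
    rw [mul_pow, mul_pow]
    have hx : 0 ≤ (Dθ^[i] (Dz^[j - l] G) p.1 p.2) ^ 2 := sq_nonneg _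
    calc (j.choose l : ℝ) ^ 2 * (((Dz₁^[l] c) p.1) ^ 2 * (Dθ^[i] (Dz^[j - l] G) p.1 p.2) ^ 2)
        ≤ 256 * (ε ^ 2 * (Dθ^[i] (Dz^[j - l] G) p.1 p.2) ^ 2) :=
          mul_le_mul hcl (mul_le_mul_of_nonneg_right hDl hx) (by positivity) (by norm_num)
      _ = 256 * ε ^ 2 * (Dθ^[i] (Dz^[j - l] G) p.1 p.2) ^ 2 := by ring
  have h3 : ∑ l ∈ range (j + 1), ((j.choose l : ℝ) * ((Dz₁^[l] c) p.1 * Dθ^[i] (Dz^[j - l] G) p.1 p.2)) ^ 2 ≤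
      256 * ε ^ 2 * ∑ l ∈ range (j + 1), (Dθ^[i] (Dz^[j - l] G) p.1 p.2) ^ 2 := by
    rw [mul_sum]; exact sum_le_sum h2
  -- reindex `l ↦ j - l`
  have h4 : ∑ l ∈ range (j + 1), (Dθ^[i] (Dz^[j - l] G) p.1 p.2) ^ 2 = ∑ l ∈ range (j + 1), (Dθ^[i] (Dz^[l] G) p.1 p.2) ^ 2 := by
    have := sum_range_reflect (fun l => (Dθ^[i] (Dz^[l] G) p.1 p.2) ^ 2) (j + 1)
    simpa using this
  rw [h4] at h3
  have hj1 : ((j + 1 : ℕ) : ℝ) ≤ 5 := by exact_mod_cast (by omega : j + 1 ≤ 5)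
  have hS : 0 ≤ ∑ l ∈ range (j + 1), (Dθ^[i] (Dz^[l] G) p.1 p.2) ^ 2 := sum_nonneg fun _ _ => sq_nonneg _
  calc (∑ l ∈ range (j + 1), (j.choose l : ℝ) * ((Dz₁^[l] c) p.1 * Dθ^[i] (Dz^[j - l] G) p.1 p.2)) ^ 2
      ≤ ((j + 1 : ℕ) : ℝ) * ∑ l ∈ range (j + 1), ((j.choose l : ℝ) * ((Dz₁^[l] c) p.1 * Dθ^[i] (Dz^[j - l] G) p.1 p.2)) ^ 2 := by
        exact_mod_cast h1
    _ ≤ 5 * (256 * ε ^ 2 * ∑ l ∈ range (j + 1), (Dθ^[i] (Dz^[l] G) p.1 p.2) ^ 2) :=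
        mul_le_mul hj1 h3 (sum_nonneg fun _ _ => sq_nonneg _) (by norm_num)
    _ = 1280 * ε ^ 2 * ∑ l ∈ range (j + 1), (Dθ^[i] (Dz^[l] G) p.1 p.2) ^ 2 := by ring

/-- **`|cG|²_{𝓗⁴} ≤ 192000ε²|G|²_{𝓗⁴}`** when `|Dz₁^lc| ≤ ε` on `(0,∞)` for `l ≤ 4`. [folklore] -/
theorem eHkNormSq_radialMul_le (α : ℝ) {c : ℝ → ℝ} (hc : ContDiffOn ℝ 4 c (Ioi 0)) {ε : ℝ}
    (hb : ∀ l, l ≤ 4 → ∀ z ∈ Ioi (0:ℝ), |(Dz₁^[l] c) z| ≤ ε) {G : ℝ → ℝ → ℝ} (hG : ContDiffOn ℝ 4 (uncurry G) strip) :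
    eHkNormSq α 4 (radialMul c G) ≤ ENNReal.ofReal (192000 * ε ^ 2) * eHkNormSq α 4 G := by
  -- every term is `≤ ofReal(1280ε²) · 5 · E(G)`
  have hterm : ∀ i j, i + j ≤ 4 → (i = 0 ∨ 1 ≤ i) →
      eL2Sq (fun z θ => Dθ^[i] (Dz^[j] (radialMul c G)) z θ * (if i = 0 then hWeight z θ else totalWeight α z θ)) ≤
        ENNReal.ofReal (1280 * ε ^ 2) * (5 * eHkNormSq α 4 G) := by
    intro i j hij _
    have hj : j ≤ 4 := by omega
    set wt : ℝ → ℝ → ℝ := fun z θ => if i = 0 then hWeight z θ else totalWeight α z θ with hwt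
    have hwtc : ContinuousOn (uncurry wt) strip := by
      by_cases hi : i = 0
      · simp only [hwt, hi, if_true]; exact continuousOn_hWeight
      · simp only [hwt, hi, if_false]; exact continuousOn_totalWeight α
    have hGl : ∀ l ∈ range (j + 1), AEMeasurable (uncurry fun z θ => Dθ^[i] (Dz^[l] G) z θ * wt z θ) (volume.restrict strip) := by
      intro l hl
      have hl' : l ≤ j := Nat.lt_succ_iff.1 (mem_range.1 hl)
      have hil : i + l ≤ 4 := by omega
      exact ((continuousOn_iterate_Dθ_Dz (N := 4) (i := i) (j := l) hG hil).mul hwtc).aemeasurable measurableSet_strip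
    have hpt : ∀ p ∈ strip, (Dθ^[i] (Dz^[j] (radialMul c G)) p.1 p.2 * wt p.1 p.2) ^ 2 ≤
        (1280 * ε ^ 2) * ∑ l ∈ range (j + 1), (Dθ^[i] (Dz^[l] G) p.1 p.2 * wt p.1 p.2) ^ 2 := by
      intro p hp
      have h := sq_iterate_radialMul_le hc hb hG hij hj hp
      have hwt2 : 0 ≤ wt p.1 p.2 ^ 2 := sq_nonneg _
      calc (Dθ^[i] (Dz^[j] (radialMul c G)) p.1 p.2 * wt p.1 p.2) ^ 2
          = (Dθ^[i] (Dz^[j] (radialMul c G)) p.1 p.2) ^ 2 * wt p.1 p.2 ^ 2 := by ring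
        _ ≤ (1280 * ε ^ 2 * ∑ l ∈ range (j + 1), (Dθ^[i] (Dz^[l] G) p.1 p.2) ^ 2) * wt p.1 p.2 ^ 2 := mul_le_mul_of_nonneg_right h hwt2
        _ = (1280 * ε ^ 2) * ∑ l ∈ range (j + 1), (Dθ^[i] (Dz^[l] G) p.1 p.2 * wt p.1 p.2) ^ 2 := by
            rw [mul_assoc, sum_mul]; congr 1; exact sum_congr rfl fun l _ => by ring
    have hle := eL2Sq_le_of_sq_le_sum (range (j + 1)) (g := fun z θ => Dθ^[i] (Dz^[j] (radialMul c G)) z θ * wt z θ) (C := 1280 * ε ^ 2) (by positivity) hGl hpt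
    refine hle.trans (mul_le_mul_right ?_ _)
    -- `Σ_{l ≤ j} eL2Sq(term_{i,l} G) ≤ 5 E(G)`
    have heach : ∀ l ∈ range (j + 1), eL2Sq (fun z θ => Dθ^[i] (Dz^[l] G) z θ * wt z θ) ≤ eHkNormSq α 4 G := by
      intro l hl
      have hl' : l ≤ j := Nat.lt_succ_iff.1 (mem_range.1 hl)
      by_cases hi : i = 0
      · simp only [hwt, hi, if_true]
        subst hi
        exact eL2Sq_hkRadialTerm_le α (k := 4) (by omega) G
      · simp only [hwt, hi, if_false]
        exact eL2Sq_hkMixedTerm_le α (k := 4) (Nat.one_le_iff_ne_zero.2 hi) (by omega) G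
    calc ∑ l ∈ range (j + 1), eL2Sq (fun z θ => Dθ^[i] (Dz^[l] G) z θ * wt z θ)
        ≤ ∑ _l ∈ range (j + 1), eHkNormSq α 4 G := sum_le_sum heach
      _ = ((j + 1 : ℕ) : ℝ≥0∞) * eHkNormSq α 4 G := by rw [sum_const, card_range, nsmul_eq_mul]
      _ ≤ 5 * eHkNormSq α 4 G := by
          refine mul_le_mul_left ?_ _
          exact_mod_cast (by omega : j + 1 ≤ 5)
  have hB := eHkNormSq_le_of_forall_le (α := α) (k := 4) (f := radialMul c G) (B := ENNReal.ofReal (1280 * ε ^ 2) * (5 * eHkNormSq α 4 G))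
    (fun j hj => by
      have := hterm 0 j (by omega) (Or.inl rfl)
      simp only [↓reduceIte] at this
      exact this)
    (fun i j hi hij => by
      have := hterm i j hij (Or.inr hi)
      have hi0 : i ≠ 0 := by omega
      simp only [hi0, ↓reduceIte] at this
      exact this)
  refine hB.trans (le_of_eq ?_)
  have h150 : ENNReal.ofReal (192000 * ε ^ 2) = 30 * 5 * ENNReal.ofReal (1280 * ε ^ 2) := by
    rw [show (192000 * ε ^ 2 : ℝ) = (30 * 5) * (1280 * ε ^ 2) by ring, ENNReal.ofReal_mul (by norm_num)]
    congr 1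
    rw [ENNReal.ofReal_mul (by norm_num), ENNReal.ofReal_ofNat, ENNReal.ofReal_ofNat]
  rw [h150, show (((4 + 1) + (4 + 1) ^ 2 : ℕ) : ℝ≥0∞) = 30 by norm_num]
  ring

/-! ### Pointwise limits for the logarithmic cut-offs -/

/-- **`D_θ^iD_R^j(η_nG) → D_θ^iD_R^jG` pointwise on the strip** (`η_n = logPlateau(log R/n)`). [folklore] -/
theorem tendsto_iterate_radialMul_etaCut {G : ℝ → ℝ → ℝ} (hG : ContDiffOn ℝ ∞ (uncurry G) strip) (i j : ℕ) {p : ℝ × ℝ} (hp : p ∈ strip) :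
    Tendsto (fun n : ℕ => Dθ^[i] (Dz^[j] (radialMul (etaCut ((n : ℝ) + 1)) G)) p.1 p.2) atTop (𝓝 (Dθ^[i] (Dz^[j] G) p.1 p.2)) := by
  have hGN : ContDiffOn ℝ ((i + j : ℕ) : WithTop ℕ∞) (uncurry G) strip := hG.of_le (by exact_mod_cast le_top)
  have hcN : ∀ n : ℕ, ContDiffOn ℝ ((i + j : ℕ) : WithTop ℕ∞) (etaCut ((n : ℝ) + 1)) (Ioi 0) := fun n =>
    (contDiffOn_etaCut _).of_le (by exact_mod_cast le_top)
  have e : ∀ n : ℕ, Dθ^[i] (Dz^[j] (radialMul (etaCut ((n : ℝ) + 1)) G)) p.1 p.2 =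
      ∑ l ∈ range (j + 1), (j.choose l : ℝ) * ((Dz₁^[l] (etaCut ((n : ℝ) + 1))) p.1 * Dθ^[i] (Dz^[j - l] G) p.1 p.2) := fun n =>
    iterate_Dθ_Dz_radialMul_Ioi (hcN n) hGN le_rfl p hp
  simp_rw [e]
  -- termwise limits: `l = 0` gives the claim, `l ≥ 1` gives `0`
  have hlim : ∀ l ∈ range (j + 1), Tendsto (fun n : ℕ => (j.choose l : ℝ) * ((Dz₁^[l] (etaCut ((n : ℝ) + 1))) p.1 * Dθ^[i] (Dz^[j - l] G) p.1 p.2)) atTop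
      (𝓝 (if l = 0 then Dθ^[i] (Dz^[j] G) p.1 p.2 else 0)) := by
    intro l _
    rcases Nat.eq_zero_or_pos l with h0 | hpos
    · subst h0
      simp only [Nat.choose_zero_right, Nat.cast_one, one_mul, Function.iterate_zero, id_eq, Nat.sub_zero, if_true]
      have := ((tendsto_etaCut p.1).mul_const (Dθ^[i] (Dz^[j] G) p.1 p.2))
      rw [one_mul] at this
      exact this
    · obtain ⟨m, rfl⟩ : ∃ m, l = m + 1 := ⟨l - 1, by omega⟩
      simp only [Nat.add_one_ne_zero, if_false]
      have h0 := tendsto_iterate_Dz₁_etaCut m hp.1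
      have := (h0.mul_const (Dθ^[i] (Dz^[j - (m + 1)] G) p.1 p.2)).const_mul (j.choose (m + 1) : ℝ)
      simpa using this
  have hsum := tendsto_finsetSum (range (j + 1)) hlim
  have e2 : (∑ l ∈ range (j + 1), if l = 0 then Dθ^[i] (Dz^[j] G) p.1 p.2 else 0) = Dθ^[i] (Dz^[j] G) p.1 p.2 := by
    rw [sum_ite_eq']; simp
  rw [e2] at hsum
  exact hsum

/-! ### Fatou for the `𝓗ᵏ` functional -/

/-- The density of the `𝓗ᵏ` functional. [folklore] -/
def hkDensity (α : ℝ) (k : ℕ) (g : ℝ → ℝ → ℝ) (p : ℝ × ℝ) : ℝ≥0∞ :=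
  (∑ j ∈ range (k + 1), ENNReal.ofReal ((hkRadialTerm j g p.1 p.2) ^ 2)) +
    ∑ i ∈ range (k + 1), ∑ j ∈ range (k + 1), if 1 ≤ i ∧ i + j ≤ k then ENNReal.ofReal ((hkMixedTerm α i j g p.1 p.2) ^ 2) else 0

/-- **The `𝓗ᵏ` functional is the lower integral of its density** (for strip-`Cᵏ` functions). [folklore] -/
theorem eHkNormSq_eq_lintegral_hkDensity (α : ℝ) {k : ℕ} {g : ℝ → ℝ → ℝ} (hg : ContDiffOn ℝ k (uncurry g) strip) :
    eHkNormSq α k g = ∫⁻ p in strip, hkDensity α k g p := by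
  unfold eHkNormSq hkDensity
  have hr : ∀ j ∈ range (k + 1), AEMeasurable (fun p : ℝ × ℝ => ENNReal.ofReal ((hkRadialTerm j g p.1 p.2) ^ 2)) (volume.restrict strip) := by
    intro j hj
    exact ((aemeasurable_hkRadialTerm_strip hg (Nat.lt_succ_iff.1 (mem_range.1 hj))).pow_const 2).ennreal_ofReal
  have hm : ∀ i ∈ range (k + 1), ∀ j ∈ range (k + 1), AEMeasurable (fun p : ℝ × ℝ =>
      if 1 ≤ i ∧ i + j ≤ k then ENNReal.ofReal ((hkMixedTerm α i j g p.1 p.2) ^ 2) else 0) (volume.restrict strip) := by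
    intro i _ j _
    by_cases h : 1 ≤ i ∧ i + j ≤ k
    · simp only [h, and_self, if_true]
      exact ((aemeasurable_hkMixedTerm_strip α hg h.2).pow_const 2).ennreal_ofReal
    · simp only [h, if_false]; exact aemeasurable_const
  have hm' : ∀ i ∈ range (k + 1), AEMeasurable (fun p : ℝ × ℝ => ∑ j ∈ range (k + 1),
      if 1 ≤ i ∧ i + j ≤ k then ENNReal.ofReal ((hkMixedTerm α i j g p.1 p.2) ^ 2) else 0) (volume.restrict strip) := fun i hi =>
    Finset.aemeasurable_sum _ (hm i hi) |>.congr (ae_of_all _ fun p => by simp [Finset.sum_apply])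
  rw [lintegral_add_left' (Finset.aemeasurable_sum _ hr |>.congr (ae_of_all _ fun p => by simp [Finset.sum_apply]))]
  rw [lintegral_finsetSum' _ hr, lintegral_finsetSum' _ hm']
  congr 1
  · refine sum_congr rfl fun j _ => ?_
    rw [eL2Sq_eq_lintegral_ofReal]
  · refine sum_congr rfl fun i hi => ?_
    rw [lintegral_finsetSum' _ (hm i hi)]
    refine sum_congr rfl fun j _ => ?_
    by_cases h : 1 ≤ i ∧ i + j ≤ k
    · simp only [h, and_self, if_true]; rw [eL2Sq_eq_lintegral_ofReal]
    · simp only [h, if_false, lintegral_zero]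

/-- **Fatou for the `𝓗ᵏ` functional**: if all mixed iterates of `g_n` converge pointwise on the strip
to those of `g` then `|g|²_{𝓗ᵏ} ≤ liminf |g_n|²_{𝓗ᵏ}`. [folklore] -/
theorem eHkNormSq_le_liminf (α : ℝ) {k : ℕ} {g : ℝ → ℝ → ℝ} {gs : ℕ → ℝ → ℝ → ℝ} (hg : ContDiffOn ℝ k (uncurry g) strip)
    (hgs : ∀ n, ContDiffOn ℝ k (uncurry (gs n)) strip)
    (hlim : ∀ i j, i + j ≤ k → ∀ p ∈ strip, Tendsto (fun n => Dθ^[i] (Dz^[j] (gs n)) p.1 p.2) atTop (𝓝 (Dθ^[i] (Dz^[j] g) p.1 p.2))) :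
    eHkNormSq α k g ≤ liminf (fun n => eHkNormSq α k (gs n)) atTop := by
  rw [eHkNormSq_eq_lintegral_hkDensity α hg]
  simp_rw [eHkNormSq_eq_lintegral_hkDensity α (hgs _)]
  -- pointwise convergence of the densities on the strip
  have hpt : ∀ p ∈ strip, Tendsto (fun n => hkDensity α k (gs n) p) atTop (𝓝 (hkDensity α k g p)) := by
    intro p hp
    unfold hkDensity
    refine Tendsto.add (tendsto_finsetSum _ fun j hj => ?_) (tendsto_finsetSum _ fun i hi => tendsto_finsetSum _ fun j hj => ?_)
    · have hj' : j ≤ k := Nat.lt_succ_iff.1 (mem_range.1 hj)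
      have h0 := hlim 0 j (by omega) p hp
      simp only [Function.iterate_zero, id_eq] at h0
      refine ENNReal.tendsto_ofReal ((Tendsto.mul_const (hWeight p.1 p.2) h0).pow 2) |>.congr' (Eventually.of_forall fun n => ?_)
      rfl
    · by_cases h : 1 ≤ i ∧ i + j ≤ k
      · simp only [h, and_self, if_true]
        have h0 := hlim i j h.2 p hp
        exact ENNReal.tendsto_ofReal ((h0.mul_const (totalWeight α p.1 p.2)).pow 2)
      · simp only [h, if_false]; exact tendsto_const_nhds
  have hmeas : ∀ n, AEMeasurable (hkDensity α k (gs n)) (volume.restrict strip) := by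
    intro n
    unfold hkDensity
    have a1 : AEMeasurable (fun p : ℝ × ℝ => ∑ j ∈ range (k + 1), ENNReal.ofReal ((hkRadialTerm j (gs n) p.1 p.2) ^ 2)) (volume.restrict strip) :=
      Finset.aemeasurable_sum (range (k + 1)) (f := fun j (p : ℝ × ℝ) => ENNReal.ofReal ((hkRadialTerm j (gs n) p.1 p.2) ^ 2)) (fun j hj => ?_) |>.congr
        (ae_of_all _ fun p => by simp [Finset.sum_apply])
    have a2 : AEMeasurable (fun p : ℝ × ℝ => ∑ i ∈ range (k + 1), ∑ j ∈ range (k + 1),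
        if 1 ≤ i ∧ i + j ≤ k then ENNReal.ofReal ((hkMixedTerm α i j (gs n) p.1 p.2) ^ 2) else 0) (volume.restrict strip) := by
      refine Finset.aemeasurable_sum (range (k + 1)) (f := fun i (p : ℝ × ℝ) => ∑ j ∈ range (k + 1),
        if 1 ≤ i ∧ i + j ≤ k then ENNReal.ofReal ((hkMixedTerm α i j (gs n) p.1 p.2) ^ 2) else 0) (fun i _ => ?_) |>.congr
        (ae_of_all _ fun p => by simp [Finset.sum_apply])
      refine Finset.aemeasurable_sum (range (k + 1)) (f := fun j (p : ℝ × ℝ) =>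
        if 1 ≤ i ∧ i + j ≤ k then ENNReal.ofReal ((hkMixedTerm α i j (gs n) p.1 p.2) ^ 2) else 0) (fun j _ => ?_) |>.congr
        (ae_of_all _ fun p => by simp [Finset.sum_apply])
      by_cases h : 1 ≤ i ∧ i + j ≤ k
      · simp only [h, and_self, if_true]
        exact ((aemeasurable_hkMixedTerm_strip α (hgs n) h.2).pow_const 2).ennreal_ofReal
      · simp only [h, if_false]; exact aemeasurable_const
    exact a1.add a2
    exact ((aemeasurable_hkRadialTerm_strip (hgs n) (Nat.lt_succ_iff.1 (mem_range.1 hj))).pow_const 2).ennreal_ofReal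
  calc ∫⁻ p in strip, hkDensity α k g p
      = ∫⁻ p in strip, liminf (fun n => hkDensity α k (gs n) p) atTop := by
        refine setLIntegral_congr_fun measurableSet_strip fun p hp => ?_
        exact ((hpt p hp).liminf_eq).symm
    _ ≤ liminf (fun n => ∫⁻ p in strip, hkDensity α k (gs n) p) atTop := lintegral_liminf_le' hmeas

end Elgindi

end Literature.Analysis.FluidPDE
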